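import Summits.BirchSwinnertonDyer.BirchSwinnertonDyer.Theorems.SignedLowerHalvesKobayashiMainConjectureSmallImageHeckePrimeMuPrelims
import Summits.BirchSwinnertonDyer.BirchSwinnertonDyer.Theorems.SignedLowerHalvesKobayashiMainConjectureSmallImageOrbitSumMuThree
import Summits.BirchSwinnertonDyer.BirchSwinnertonDyer.Theorems.PrintX9EvenBranchMuZeroInputFree
import Literature.NumberTheory.EllipticCurves.SupersingularIrreducibleProofs
import Literature.NumberTheory.EllipticCurves.SerreOpenImageOrdinaryInertiaProofs
import HarnessLib

/-!
# Route `SignedLowerHalves`, crux `KobayashiMainConjectureSmallImage` (item stmt-BirchSwinnertonDyer-19002),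
# line `birth_acns`: **the one-sign analytic μ-rider at `p = 3`, INPUT-FREE** —
# `min(μ(L₃⁺(f)), μ(L₃⁻(f))) = 0` for the newform `f` of EVERY elliptic curve over `ℚ` with good reduction at `3` and `a₃ = 0`
# (cell `bsd-ssimc`, seat `bsd-line-slh-p3` gen 8; THEOREMS ONLY; helper)

The `p = 3` half of the line's one-sign μ-rider, derived from THEOREMS OF THE TREE and nothing else — no stub, no named fact:

* `Rank1Residual.EvenBranch.cycWindingNonConstantAt_of_odd` (`Theorems/PrintX9EvenBranchMuZeroInputFree.lean`, cells bsd-f3-mu /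
  bsd-print-x8 / x9 / x10b): for an ODD good prime `p` with `E[p]` irreducible, the plus symbol `a ↦ [a/pⁿ]⁺_f` is NON-CONSTANT
  `p`-adically on the `p`-power cusps (`CycWindingNonConstantAt W p`) — THEOREM B «the `p`-power cyclotomic winding classes span
  `pr Γ_H(N)`» by the orbit trick in `SL₂(ℤ[1/p])` from **Vaserstein's theorem `G(ℤ[1/p], N·ℤ[1/p]) = E(ℤ[1/p], N·ℤ[1/p])`, PROVED in
  the tree** (`Literature/NumberTheory/Automorphic/CongruenceSubgroupPropertySL2AwayHolds.lean`), then the vertical Stevens bridge;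
* `hasIrreducibleModPGaloisRep_of_dvd_frobeniusTrace` (Serre 1972 §1.11 Prop. 12, tree): good supersingular `p ≠ 2` ⇒ `E[p]` irreducible;
* this seat's Modules 1b/2′ (`…SmallImageOrbitSumMuThree`, `…SmallImageHeckePrimeMuPrelims`): `3`-integrality of `[a/3^k]⁺`, the
  `K₀`-step at the cusp `0` (`norm_ratPlusSymbol_zero_lt_one`), and «one unit plus symbol `[u/3^{n+1}]⁺` ⇒ a signed Pollack function
  with unit content» (roots of unity `±1` in `ℤ₃`, Pollack's Prop. 6.18 proved integrally in the tree).

Main results: `exists_norm_ratPlusSymbol_eq_one_of_nonConstant` (non-constancy ⇒ some `[a/p^k]⁺`, `k ≥ 1`, `p ∤ a`, is a `p`-adic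
unit; any odd `p`, `a_p = 0`, `p ∤ N`), `exists_unit_norm_ratPlusSymbol_eq_one_of_nonConstant` (unit-residue form),
`exists_unit_norm_ratPlusSymbol_three_eq_one_of_isNewformOf` and **`exists_sign_hasUnitContent_three_of_isNewformOf`**:
for `W/ℚ` globally minimal with good reduction at `3` and `a₃ = 0` and its newform `f`,
`∃ ε L, IsSignedPAdicLFunction f 3 ε L ∧ HasUnitContent L`.  This DISCHARGES the `p = 3` μ-stub of line `birth_acns`
(v6 `stub_muOneSign_ns_three` / v7 `stub_lemmaPrime_three` / v8 `stub_SpGenerates_three` / v9 `stub_vasersteinLiehl_three` all become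
unnecessary: the ideator bsd-idea-13's EG-REDUCTION is realised by the tree's own THEOREM B road).  HONEST SCOPE: this is the analytic
one-sign `μ = 0` at `p = 3` only; crux 4 (`KobayashiMainConjectureSmallImage`) stays OPEN (engine stubs); BSD is not proved by any of this.

References: [MazurTateTeitelbaum1986Invent] §I.4 (4.2), §I.8, §I.10 (10.1); [PollackWeston2011] Thm. 4.1 (1), Rem. 4.2;
[Vaserstein1972SL2] Theorem; [Manin1972] Prop. 1.4, Thm. 1.9; [Serre1972] §1.11 Prop. 12.
-/

-- D-0017: single-problem summit, the namespace repeats the problem name by design.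
set_option linter.dupNamespace false
set_option autoImplicit false

noncomputable section

open scoped Classical MatrixGroups ModularForm

open CongruenceSubgroup Literature.NumberTheory.EllipticCurves Literature.NumberTheory.EllipticCurves.ModularForms
  Literature.NumberTheory.EllipticCurves.Kobayashi2003 Literature.NumberTheory.EllipticCurves.GreenbergVatsal2000
  Literature.NumberTheory.EllipticCurves.Rank1Residual

namespace Summit.BirchSwinnertonDyer.BirchSwinnertonDyer.Theorems.SmallImageCycWindingMuThree

open Summit.BirchSwinnertonDyer.BirchSwinnertonDyer.Theorems.SmallImageHeckePrimeMu
  (norm_ratPlusSymbol_intCast_div_pow_le_one norm_ratPlusSymbol_zero_lt_one)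

variable {N : ℕ} [NeZero N] (f : CuspForm (Gamma0 N) 2) {p : ℕ} [Fact p.Prime]

/-! ## §1 From a unit value `[b/pⁿ]⁺` to a unit value at a REDUCED `p`-power cusp `[a/p^k]⁺`, `k ≥ 1`, `p ∤ a` -/

/-- **Descent of a unit plus symbol to a reduced `p`-power cusp**: `p` odd, `p ∤ N`, `a_p(f) = 0`, rational newform `f`;
if `‖[b/pⁿ]⁺_f‖_p = 1` for some `b ∈ ℤ`, `n ≥ 0`, then `‖[a/p^k]⁺_f‖_p = 1` for some `k ≥ 1` and `a` prime to `p`.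
(Cancel powers of `p` in `b/pⁿ`; at `n = 0`, `[b]⁺ = [0]⁺` and the `K₀`-step `2[0]⁺ = -Σ_{u ∈ (ℤ/p)ˣ} [u/p]⁺` of
`norm_ratPlusSymbol_zero_lt_one` produces a unit `[u/p]⁺`.) [cite: MazurTateTeitelbaum1986Invent, §I.4 (4.2)] -/
theorem exists_norm_ratPlusSymbol_eq_one_of_norm_eq_one (hp2 : p ≠ 2) (hf0 : IsNewform0 f) (hQ : coeffField f = ⊥)
    (hpN : ¬ p ∣ N) (hap : cuspCoeff f p = ((0 : ℤ) : ℂ)) (n : ℕ) (b : ℤ)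
    (hb : ‖((ratPlusSymbol f ((b : ℚ) / (p : ℚ) ^ n) : ℚ) : ℚ_[p])‖ = 1) :
    ∃ (k : ℕ) (a : ℤ), 1 ≤ k ∧ IsCoprime a (p : ℤ) ∧
      ‖((ratPlusSymbol f ((a : ℚ) / (p : ℚ) ^ k) : ℚ) : ℚ_[p])‖ = 1 := by
  have hp : p.Prime := Fact.out
  have hpint : Prime (p : ℤ) := Nat.prime_iff_prime_int.mp hp
  induction n generalizing b with
  | zero =>
    -- `[b]⁺ = [0]⁺`
    have h0 : ratPlusSymbol f ((b : ℚ) / (p : ℚ) ^ 0) = ratPlusSymbol f 0 := by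
      rw [pow_zero, div_one, ← zero_add (b : ℚ), ratPlusSymbol_add_intCast_eq]
    rw [h0] at hb
    by_contra hne
    push Not at hne
    have hH1 : ∀ a : ℤ, IsCoprime a (p : ℤ) → ‖((ratPlusSymbol f ((a : ℚ) / (p : ℚ) ^ 1) : ℚ) : ℚ_[p])‖ < 1 := by
      intro a ha
      exact lt_of_le_of_ne (norm_ratPlusSymbol_intCast_div_pow_le_one f hp2 hf0 hpN hap a 1) (hne 1 a le_rfl ha)
    have hlt := norm_ratPlusSymbol_zero_lt_one f hp2 hf0 hQ hpN hap hH1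
    rw [hb] at hlt
    exact lt_irrefl _ hlt
  | succ m ih =>
    by_cases hdvd : (p : ℤ) ∣ b
    · obtain ⟨c, rfl⟩ := hdvd
      have hpq : (p : ℚ) ≠ 0 := by exact_mod_cast hp.ne_zero
      have heq : (((p : ℤ) * c : ℤ) : ℚ) / (p : ℚ) ^ (m + 1) = (c : ℚ) / (p : ℚ) ^ m := by
        push_cast
        rw [pow_succ]
        field_simp
      rw [heq] at hb
      exact ih c hb
    · exact ⟨m + 1, b, by omega, (hpint.coprime_iff_not_dvd.mpr hdvd).symm, hb⟩

/-- **Non-constancy ⇒ a unit plus symbol at a reduced `p`-power cusp**: `p` odd, `p ∤ N`, `a_p(f) = 0`, rational newform `f`;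
if `1 ≤ ‖[a/pⁿ]⁺ - [a'/pⁿ]⁺‖_p` for some `n, a, a'` (the shape of `CycWindingNonConstantAt`), then `‖[a/p^k]⁺_f‖_p = 1` for some
`k ≥ 1`, `p ∤ a` (ultrametric inequality + `p`-integrality of `[·/p^k]⁺` + the descent above).
[cite: MazurTateTeitelbaum1986Invent, §I.4 (4.2), §I.10 (10.1)] -/
theorem exists_norm_ratPlusSymbol_eq_one_of_nonConstant (hp2 : p ≠ 2) (hf0 : IsNewform0 f) (hQ : coeffField f = ⊥)
    (hpN : ¬ p ∣ N) (hap : cuspCoeff f p = ((0 : ℤ) : ℂ))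
    (h : ∃ (n : ℕ) (a a' : ℤ), 1 ≤ ‖((ratPlusSymbol f ((a : ℚ) / (p : ℚ) ^ n) - ratPlusSymbol f ((a' : ℚ) / (p : ℚ) ^ n) : ℚ) :
        ℚ_[p])‖) :
    ∃ (k : ℕ) (a : ℤ), 1 ≤ k ∧ IsCoprime a (p : ℤ) ∧
      ‖((ratPlusSymbol f ((a : ℚ) / (p : ℚ) ^ k) : ℚ) : ℚ_[p])‖ = 1 := by
  obtain ⟨n, a, a', h1⟩ := h
  -- ultrametric: one of the two symbols has norm `≥ 1`, hence `= 1`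
  have hmax : 1 ≤ max ‖((ratPlusSymbol f ((a : ℚ) / (p : ℚ) ^ n) : ℚ) : ℚ_[p])‖
      ‖((ratPlusSymbol f ((a' : ℚ) / (p : ℚ) ^ n) : ℚ) : ℚ_[p])‖ := by
    refine le_trans h1 ?_
    push_cast
    rw [sub_eq_add_neg]
    refine le_trans (IsUltrametricDist.norm_add_le_max _ _) ?_
    rw [norm_neg]
  rcases le_max_iff.mp hmax with ha | ha'
  · exact exists_norm_ratPlusSymbol_eq_one_of_norm_eq_one f hp2 hf0 hQ hpN hap n a
      (le_antisymm (norm_ratPlusSymbol_intCast_div_pow_le_one f hp2 hf0 hpN hap a n) ha)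
  · exact exists_norm_ratPlusSymbol_eq_one_of_norm_eq_one f hp2 hf0 hQ hpN hap n a'
      (le_antisymm (norm_ratPlusSymbol_intCast_div_pow_le_one f hp2 hf0 hpN hap a' n) ha')

/-! ## §2 Unit-residue form -/

/-- **Unit-residue form**: under the same hypotheses, some `[u/p^{n+1}]⁺_f` with `u` a UNIT of `ℤ/p^{n+1}` (represented in
`[0, p^{n+1})`) is a `p`-adic unit (`ℤ`-periodicity of `[·]⁺`). [cite: MazurTateTeitelbaum1986Invent, §I.4 (4.2)] -/
theorem exists_unit_norm_ratPlusSymbol_eq_one_of_nonConstant (hp2 : p ≠ 2) (hf0 : IsNewform0 f) (hQ : coeffField f = ⊥)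
    (hpN : ¬ p ∣ N) (hap : cuspCoeff f p = ((0 : ℤ) : ℂ))
    (h : ∃ (n : ℕ) (a a' : ℤ), 1 ≤ ‖((ratPlusSymbol f ((a : ℚ) / (p : ℚ) ^ n) - ratPlusSymbol f ((a' : ℚ) / (p : ℚ) ^ n) : ℚ) :
        ℚ_[p])‖) :
    ∃ (n : ℕ) (u : (ZMod (p ^ (n + 1)))ˣ),
      ‖((ratPlusSymbol f (((u : ZMod (p ^ (n + 1))).val : ℚ) / (p : ℚ) ^ (n + 1)) : ℚ) : ℚ_[p])‖ = 1 := by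
  have hp : p.Prime := Fact.out
  obtain ⟨k, a, hk, ha, hnorm⟩ := exists_norm_ratPlusSymbol_eq_one_of_nonConstant f hp2 hf0 hQ hpN hap h
  obtain ⟨n, rfl⟩ : ∃ n, k = n + 1 := ⟨k - 1, by omega⟩
  haveI : NeZero (p ^ (n + 1)) := ⟨pow_ne_zero _ hp.ne_zero⟩
  -- `a` is a unit modulo `p^{n+1}`
  have hunit : IsUnit ((a : ℤ) : ZMod (p ^ (n + 1))) := by
    have hapk : IsCoprime a ((p : ℤ) ^ (n + 1)) := ha.pow_right
    obtain ⟨x, y, hxy⟩ := hapk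
    refine IsUnit.of_mul_eq_one ((x : ℤ) : ZMod (p ^ (n + 1))) ?_
    have hp0 : ((p : ℕ) : ZMod (p ^ (n + 1))) ^ (n + 1) = 0 := by
      rw [← Nat.cast_pow, ZMod.natCast_self]
    have h := congr_arg (fun z : ℤ ↦ (z : ZMod (p ^ (n + 1)))) hxy
    simp only [Int.cast_add, Int.cast_mul, Int.cast_pow, Int.cast_natCast, Int.cast_one, hp0, mul_zero,
      add_zero] at h
    rw [mul_comm]
    exact h
  obtain ⟨u, hu⟩ := hunit
  refine ⟨n, u, ?_⟩
  -- `[u.val/p^{n+1}]⁺ = [a/p^{n+1}]⁺` by periodicity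
  have hval : (((u : ZMod (p ^ (n + 1))).val : ℤ)) = a % (p ^ (n + 1) : ℕ) := by
    rw [hu, ZMod.val_intCast]
  have heq : (((u : ZMod (p ^ (n + 1))).val : ℚ) / (p : ℚ) ^ (n + 1)) =
      (a : ℚ) / (p : ℚ) ^ (n + 1) + ((-(a / (p ^ (n + 1) : ℕ)) : ℤ) : ℚ) := by
    have hpq : ((p : ℚ) ^ (n + 1)) ≠ 0 := pow_ne_zero _ (by exact_mod_cast hp.ne_zero)
    have hdiv := Int.mul_ediv_add_emod a (p ^ (n + 1) : ℕ)
    have hvalq : (((u : ZMod (p ^ (n + 1))).val : ℚ)) = ((a % (p ^ (n + 1) : ℕ) : ℤ) : ℚ) := by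
      exact_mod_cast hval
    rw [hvalq]
    field_simp
    have h2 : ((a % (p ^ (n + 1) : ℕ) : ℤ) : ℚ) = (a : ℚ) - ((p ^ (n + 1) : ℕ) : ℚ) * ((a / (p ^ (n + 1) : ℕ) : ℤ) : ℚ) := by
      have h3 : (((p ^ (n + 1) : ℕ) : ℤ) * (a / (p ^ (n + 1) : ℕ)) + a % (p ^ (n + 1) : ℕ) : ℤ) = a := hdiv
      have h4 := congr_arg (fun z : ℤ ↦ (z : ℚ)) h3
      push_cast at h4 ⊢
      linarith
    rw [h2]
    push_cast
    ring
  rw [heq, ratPlusSymbol_add_intCast_eq]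
  exact hnorm

/-! ## §3 The newform of an elliptic curve at `p = 3`: everything is a theorem of the tree -/

/-- **`E[3]` is irreducible at a good prime `3` with `a₃ = 0`** (good SUPERSINGULAR reduction; Serre 1972 Prop. 12 in the tree:
`hasIrreducibleModPGaloisRep_of_dvd_frobeniusTrace`, `3 ∤ Δ_min` from good reduction). [cite: Serre1972, §1.11 Prop. 12] -/
theorem hasIrreducibleModPGaloisRep_three_of_frobeniusTrace_eq_zero (W : WeierstrassCurve ℚ) [W.IsElliptic] [W.IsGloballyMinimal]
    (hgood : W.HasGoodReductionAtPrime 3) (hap : W.frobeniusTrace 3 = 0) : W.HasIrreducibleModPGaloisRep 3 :=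
  haveI : Fact (Nat.Prime 3) := ⟨Nat.prime_three⟩
  hasIrreducibleModPGaloisRep_of_dvd_frobeniusTrace W 3 (by decide)
    (W.not_dvd_minimalDiscriminantInt_of_hasGoodReductionAtPrime' 3 hgood) (by rw [hap]; exact dvd_zero _)

/-- **A unit plus symbol at `3` for the newform of every curve with good reduction at `3` and `a₃ = 0`**: for `W/ℚ` globally minimal,
`f` its newform of level `N`, some `[u/3^{n+1}]⁺_f` (`u` a unit mod `3^{n+1}`) is a `3`-adic unit.  Non-constancy of the `3`-power
cyclotomic winding symbols (`EvenBranch.cycWindingNonConstantAt_of_odd`, input-free THEOREM B road of the tree) + irreducibility of `E[3]`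
(supersingular) + §§1–2. [cite: MazurTateTeitelbaum1986Invent, §I.10 (10.1)] [cite: Vaserstein1972SL2, Theorem] -/
theorem exists_unit_norm_ratPlusSymbol_three_eq_one_of_isNewformOf {W : WeierstrassCurve ℚ} [W.IsElliptic] [W.IsGloballyMinimal]
    (hf : IsNewformOf W f) (hgood : W.HasGoodReductionAtPrime 3) (hap : W.frobeniusTrace 3 = 0) :
    ∃ (n : ℕ) (u : (ZMod (3 ^ (n + 1)))ˣ),
      ‖((ratPlusSymbol f (((u : ZMod (3 ^ (n + 1))).val : ℚ) / (3 : ℚ) ^ (n + 1)) : ℚ) : ℚ_[3])‖ = 1 := by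
  haveI : Fact (Nat.Prime 3) := ⟨Nat.prime_three⟩
  have h32 : (3 : ℕ) ≠ 2 := by decide
  have h3N : ¬ 3 ∣ N := not_dvd_level_of_isNewformOf hf hgood
  have hap' : cuspCoeff f 3 = ((0 : ℤ) : ℂ) := by
    rw [cuspCoeff_eq_frobeniusTrace_of_isNewformOf_holds hf hgood, hap]
  have hirr := hasIrreducibleModPGaloisRep_three_of_frobeniusTrace_eq_zero W hgood hap
  have hnc : CycWindingNonConstantAt W 3 :=
    Summit.BirchSwinnertonDyer.BirchSwinnertonDyer.Rank1Residual.EvenBranch.cycWindingNonConstantAt_of_odd W 3 h32 hgood hirr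
  have h := hnc f hf
  exact_mod_cast exists_unit_norm_ratPlusSymbol_eq_one_of_nonConstant f h32 hf.1 hf.coeffField_eq_bot h3N hap'
    (by exact_mod_cast h)

/-- **THE ONE-SIGN μ-RIDER AT `p = 3`, input-free**: for `W/ℚ` globally minimal with good reduction at `3` and `a₃ = 0` and its newform
`f` of level `N`, one of Pollack's signed `3`-adic `L`-functions of `f` has UNIT CONTENT: `∃ ε L, IsSignedPAdicLFunction f 3 ε L ∧ HasUnitContent L`,
i.e. `min(μ(L₃⁺(f)), μ(L₃⁻(f))) = 0`.  (= `exists_unit_norm_ratPlusSymbol_three_eq_one_of_isNewformOf` + this seat's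
`SmallImageOrbitSumMuThree.exists_sign_hasUnitContent_three_of_norm_ratPlusSymbol_eq_one`, p636964.)  Discharges the `p = 3` μ-stub of line
`birth_acns` of crux `KobayashiMainConjectureSmallImage`; says nothing about the engine stubs, the crux, or BSD.
[cite: PollackWeston2011, Thm. 4.1 (1), Rem. 4.2] [cite: MazurTateTeitelbaum1986Invent, §I.10 (10.1)] [cite: Vaserstein1972SL2, Theorem] -/
theorem exists_sign_hasUnitContent_three_of_isNewformOf {W : WeierstrassCurve ℚ} [W.IsElliptic] [W.IsGloballyMinimal]
    (hf : IsNewformOf W f) (hgood : W.HasGoodReductionAtPrime 3) (hap : W.frobeniusTrace 3 = 0) :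
    ∃ (ε : ℤˣ) (L : IwasawaAlgebra 3), IsSignedPAdicLFunction f 3 ε L ∧ HasUnitContent L := by
  obtain ⟨n, u, hunit⟩ := exists_unit_norm_ratPlusSymbol_three_eq_one_of_isNewformOf f hf hgood hap
  exact Summit.BirchSwinnertonDyer.BirchSwinnertonDyer.Theorems.SmallImageOrbitSumMuThree.exists_sign_hasUnitContent_three_of_norm_ratPlusSymbol_eq_one
    f hf hgood hap u hunit

end Summit.BirchSwinnertonDyer.BirchSwinnertonDyer.Theorems.SmallImageCycWindingMuThree

end
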